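import Literature.AnabelianGeometry.EtaleTheta.BiKummerOfModel
import Literature.AnabelianGeometry.EtaleTheta.TemperedFrobenioidCor38SubOTriDegree
import HarnessLib

/-!
# [EtTh] Cor. 3.8, proof rows C38-L04 / [FrdI] Thm. 3.4 (iii) "preserves Frobenius degrees": at a Frobenius-trivial object,
# EVERY `h : Cor38Hyp C₁ C₂` acts on the degrees of base-identity endomorphisms through ONE endomorphism of `ℕ_{≥1}`

S. Mochizuki, *The étale theta function and its Frobenioid-theoretic manifestations*, Publ. RIMS **45** (2009), Cor. 3.8,
proof, PDF p. 81 l. 5–8 ("`Ψ` preserves the submonoids '`O^▷(−)`'") [cite: MochizukiEtTh2009, Cor 3.8 p.81]; S. Mochizuki,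
*The geometry of Frobenioids I*, Kyushu J. Math. **62** (2008), Def. 1.2 (iv) p. 23 (Frobenius-trivial objects: a section
`ζ : ℕ_{≥1} → End(A)` of the Frobenius degree by base-identity endomorphisms of Frobenius type; Frobenius-normalized objects),
Thm. 3.4 (iii) p. 62 ("`Ψ` preserves … Frobenius degrees"), Thm. 5.2 (i) p. 100 [cite: MochizukiFrdI2008, Def. 1.2 (iv) p.23].

abc-iut cell, block F, seat abc-iut-f-133 (gen 2); sequel of `TemperedFrobenioidCor38SubOTriDegree.lean` (p449107).  PROOF-ONLY
(0 definitions).  KERNEL piece of the closure-side census of rows F-2809 / F-2812 / F-2815 of `TemperedFrobenioidCor38Sub.lean`: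
for EVERY record `h : Cor38Hyp C₁ C₂` (no slimness / FSMFF-ness / non-dilation used) and every Frobenius-trivial object `A` of
`C₁`, there is a monoid endomorphism `τ : ℕ_{≥1} → ℕ_{≥1}` with `deg_Fr(Ψ φ) = τ(deg_Fr φ)` for EVERY base-identity endomorphism
`φ` of `A` (`Cor38Hyp.exists_degFrHom_of_isFrobeniusTrivial`).  Mechanism (model Frobenioid, [FrdI] Thm. 5.2 (i)): a
base-identity endomorphism `φ` of degree `d` factors as `φ = t ∘ ζ(d)` with `t ∈ O^▷(A)` (`ζ(d)` is isometric, `B(A)` is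
group-like — `TemperedFrobenioid.exists_endSubmonoid_comp_of_isometric`), and `deg_Fr(Ψ t) = 1` by degree rigidity of `O^▷`
(p449107); so `deg_Fr(Ψ φ) = deg_Fr(Ψ ζ(d))`, multiplicative in `d`.  In particular `τ(1) = 1` recovers linearity
preservation for base-identity linear endomorphisms.  `τ = id` is NOT claimed (it is what [FrdI] Thm. 3.4 (iii) asserts for
Frobenioids of standard type; nothing here decides the universal closures).  HONEST FRAMING: refereed pre-IUT material; nothing
here bears on [IUTchIII] Cor. 3.12; typed ≠ proved.
-/

namespace Literature.AnabelianGeometry.EtaleTheta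

open CategoryTheory Opposite Literature.AlgebraicGeometry.Frobenioids

universe u₀ v₀ u v w

/-! ### Model Frobenioids: a base-identity endomorphism factors through any isometric one of the same degree -/

section Model

variable {D : Type u} [Category.{v} D] {Φ B : Dᵒᵖ ⥤ CommMonCat.{w}} {DivB : B ⟶ monoidGp Φ}

/-- The relation bookkeeping behind the factorisation `φ = t ∘ ζ`. [folklore] -/
private theorem rel_aux {G : Type w} [CommGroup G] {c z vφ vζ vw : G} {d : ℕ} (hφ : c ^ d * z = c * vφ)
    (hζ : c ^ d * 1 = c * vζ) (hw : vζ * vw = 1) : c * z = c * (vφ * vw) := by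
  rw [mul_one] at hζ
  have h1 : c * vφ = c * vζ * z := by rw [← hφ, hζ]
  symm
  calc c * (vφ * vw) = c * vφ * vw := (mul_assoc _ _ _).symm
    _ = c * vζ * z * vw := by rw [h1]
    _ = c * z * (vζ * vw) := by ac_rfl
    _ = c * z := by rw [hw, mul_one]

/-- **In a model Frobenioid, a base-identity endomorphism `φ` of `(A_D, α)` factors as `φ = t ∘ ζ` through any ISOMETRIC
base-identity endomorphism `ζ` of the same Frobenius degree whose `u_ζ` is invertible, with `t = (1, id, Div φ, u_φ u_ζ⁻¹)`
a base-identity LINEAR endomorphism** (the relation for `t` follows from those of `φ`, `ζ`: `Div φ = Div_B(u_φ) − Div_B(u_ζ)`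
in `Φ(A_D)^gp`).  [cite: MochizukiFrdI2008, Thm. 5.2(i) p.100] -/
theorem ModelFrobenioid.exists_linear_comp_of_isometric {X : ModelFrobenioid Φ B DivB} (ζ φ : X ⟶ X)
    (hζb : ModelFrobenioid.baseMap ζ = 𝟙 X.base) (hφb : ModelFrobenioid.baseMap φ = 𝟙 X.base)
    (hdeg : ModelFrobenioid.degFr ζ = ModelFrobenioid.degFr φ) (hζd : ModelFrobenioid.div ζ = 1)
    (hu : IsUnit (ModelFrobenioid.unit ζ)) :
    ∃ t : X ⟶ X, ModelFrobenioid.degFr t = 1 ∧ ModelFrobenioid.baseMap t = 𝟙 X.base ∧ ζ ≫ t = φ := by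
  obtain ⟨w, hw⟩ := hu.exists_right_inv
  have hφr := ModelFrobenioid.rel φ
  have hζr := ModelFrobenioid.rel ζ
  rw [hφb, pullGp_id] at hφr
  rw [hζb, pullGp_id, hζd, map_one, hdeg] at hζr
  have hw' : divB Φ B DivB (op X.base) (ModelFrobenioid.unit ζ) * divB Φ B DivB (op X.base) w = 1 := by
    rw [← map_mul, hw, map_one]
  let t : X ⟶ X :=
    { degFr := 1
      base := 𝟙 X.base
      div := ModelFrobenioid.div φ
      unit := ModelFrobenioid.unit φ * w
      rel := by
        rw [PNat.one_coe, pow_one, pullGp_id, map_mul]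
        exact rel_aux hφr hζr hw' }
  refine ⟨t, rfl, rfl, ?_⟩
  apply ModelFrobenioid.hom_ext
  · rw [ModelFrobenioid.degFr_comp, ← hdeg]
    exact one_mul _
  · rw [ModelFrobenioid.baseMap_comp, hζb, hφb]
    exact Category.id_comp _
  · rw [ModelFrobenioid.div_comp, hζb, hζd, one_pow, mul_one, op_id, Φ.map_id, CommMonCat.hom_id,
      MonoidHom.id_apply]
  · rw [ModelFrobenioid.unit_comp, hζb, op_id, B.map_id, CommMonCat.hom_id, MonoidHom.id_apply]
    change ModelFrobenioid.unit φ * w * ModelFrobenioid.unit ζ ^ ((1 : ℕ+) : ℕ) = ModelFrobenioid.unit φ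
    rw [PNat.one_coe, pow_one, mul_assoc, mul_comm w, hw, mul_one]

end Model

/-! ### Tempered Frobenioids: the degree of `Ψ φ` for base-identity `φ` at a Frobenius-trivial object -/

section Rows

variable {D₀ : Type u₀} [Category.{v₀} D₀] {V : FrdIMonoidStub.{w}} {T : RealifiedDivisorMonoids (D₀ := D₀) V}
  {D : Type u} [Category.{v} D] {VD : FrdICatStub.{u, v, w} D}
  {D₀' : Type u₀} [Category.{v₀} D₀'] {T' : RealifiedDivisorMonoids (D₀ := D₀') V}
  {D' : Type u} [Category.{v} D'] {VD' : FrdICatStub.{u, v, w} D'}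
  {C₁ : TemperedFrobenioid T D VD} {C₂ : TemperedFrobenioid T' D' VD'}

/-- **In a tempered Frobenioid, every base-identity endomorphism `φ` of an object `A` factors as `φ = t ∘ ζ` through any
base-identity endomorphism `ζ` of Frobenius type of the same degree, with `t ∈ O^▷(A)`** (`B(A)` is group-like, [EtTh]
Def. 3.6 (i)/(ii): `TemperedFrobenioid.isUnit_ratFnFunctor`). [cite: MochizukiEtTh2009, Def 3.6 p.77] -/
theorem TemperedFrobenioid.exists_endSubmonoid_comp_of_isometric (C : TemperedFrobenioid T D VD) {A : C.category}
    (ζ φ : End A) (hζb : C.opsData.IsBaseIdentity ζ) (hφb : C.opsData.IsBaseIdentity φ)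
    (hdeg : C.opsData.degFr ζ = C.opsData.degFr φ) (hζd : C.opsData.IsIsometry ζ) :
    ∃ t ∈ C.opsData.endSubmonoid A, φ = t * ζ := by
  obtain ⟨t, htd, htb, hcomp⟩ := ModelFrobenioid.exists_linear_comp_of_isometric ζ φ hζb hφb hdeg hζd
    (C.isUnit_ratFnFunctor T.isUnit_BΛ A (ModelFrobenioid.unit ζ))
  exact ⟨t, ⟨htb, htd⟩, hcomp.symm⟩

namespace Cor38Hyp

variable (h : Cor38Hyp C₁ C₂)

/-- **Degree transport at a Frobenius-trivial object, for EVERY `h : Cor38Hyp C₁ C₂`**: if `A` is Frobenius-trivial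
([FrdI] Def. 1.2 (iv)), there is a monoid endomorphism `τ` of `ℕ_{≥1}` with `deg_Fr(Ψ φ) = τ(deg_Fr φ)` for every
base-identity endomorphism `φ` of `A` — `τ(d) = deg_Fr(Ψ ζ(d))`; a base-identity `φ` of degree `d` is `t ∘ ζ(d)` with
`t ∈ O^▷(A)`, and `deg_Fr(Ψ t) = 1` by degree rigidity of `O^▷` (`isLinear_map_of_isFrobeniusTrivial`).  (`τ = id` — [FrdI]
Thm. 3.4 (iii) for Frobenioids of standard type — is NOT claimed here.) [cite: MochizukiEtTh2009, Cor 3.8 p.81] -/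
theorem exists_degFrHom_of_isFrobeniusTrivial {A : C₁.category} (hA : C₁.opsData.IsFrobeniusTrivial A) :
    ∃ τ : ℕ+ →* ℕ+, ∀ φ : End A, C₁.opsData.IsBaseIdentity φ →
      C₂.opsData.degFr (h.Ψ.functor.map φ) = τ (C₁.opsData.degFr φ) := by
  obtain ⟨ζ, hζ⟩ := hA
  let τ : ℕ+ →* ℕ+ :=
    { toFun := fun n => C₂.opsData.degFr (h.Ψ.functor.map (ζ n))
      map_one' := by
        rw [map_one, End.one_def, h.Ψ.functor.map_id]
        exact C₂.opsData.degFr_id _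
      map_mul' := fun m n => by
        rw [map_mul, End.mul_def, h.Ψ.functor.map_comp, C₂.opsData.degFr_comp, mul_comm] }
  refine ⟨τ, fun φ hφ => ?_⟩
  set d := C₁.opsData.degFr φ with hd_def
  obtain ⟨hd, hb, hft⟩ := hζ d
  obtain ⟨t, ht, heq⟩ := C₁.exists_endSubmonoid_comp_of_isometric (ζ d) φ hb hφ hd hft.1.2
  have hlin : C₂.opsData.IsLinear (h.Ψ.functor.map t) :=
    isLinear_map_of_isFrobeniusTrivial C₁.opsData C₂.opsData h.Ψ.functor C₁.opsData_isOfFrobeniusNormalizedType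
      ⟨ζ, hζ⟩ ht
  rw [heq, End.mul_def, h.Ψ.functor.map_comp, C₂.opsData.degFr_comp,
    show C₂.opsData.degFr (h.Ψ.functor.map t) = 1 from hlin, mul_one]
  rfl

/-- The same for `Ψ⁻¹`. [cite: MochizukiEtTh2009, Cor 3.8 p.81] -/
theorem exists_degFrHom_inverse_of_isFrobeniusTrivial {A : C₂.category} (hA : C₂.opsData.IsFrobeniusTrivial A) :
    ∃ τ : ℕ+ →* ℕ+, ∀ φ : End A, C₂.opsData.IsBaseIdentity φ →
      C₁.opsData.degFr (h.Ψ.inverse.map φ) = τ (C₂.opsData.degFr φ) :=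
  exists_degFrHom_of_isFrobeniusTrivial
    ({ Ψ := h.Ψ.symm, fsmff := ⟨h.fsmff.2, h.fsmff.1⟩, nonDilating := ⟨h.nonDilating.2, h.nonDilating.1⟩ } :
      Cor38Hyp C₂ C₁) hA

end Cor38Hyp

end Rows

end Literature.AnabelianGeometry.EtaleTheta
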